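import Summits.HodgeConjecture.HodgeConjecture.Theorems.R90S6TwistedTorusDescent        -- ★ 1c (p01): `epsCentralizer`, `descEpsConj`, `inclQuot`, `standardLeviGL`, the `GL_n(F)` local-field frame (`isOpen_glInt`)
import Summits.HodgeConjecture.HodgeConjecture.Theorems.R90S6TwistedUnipotentJacobian   -- ★ TJ1 B (this seat): `UnitaryGroup.qsInvolution`, `coe_qsInvolution_apply`; ★ TJ1 A brings `normAbs_neg`, `LocalFieldLinearJacobian`
import Literature.NumberTheory.Automorphic.SatakeTransformGL                              -- ★ `iwasawaExp` (`_eq`, `_mul_of_mem_glInt`), `zpowDiagGL`, `exists_eq_zpow_mul_of_ne_zero`, `diagonalGL_mem_glInt`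
import HarnessLib

/-!
# R90 · S6 «Ch. 14.1–14.5 stable TF» — CARD TB2a FILE 2a (row E1.4.4.2.1 ∕ TB2d): THE ε-NORM FIBRE SUM — the `M̃ ⧸ G̃_{δε}` integral of the twisted
# torus descent at a hyperbolic-norm `δ` is `vol(U₀) · Σ_{(n,m) ∈ ℤ²} G(e(δ) + (n, 2m, n))` (`Theorems/R90S6TwistedTorusFibreSum.lean`)

Cell `hodgecm-mathlib`, crux H413 (`stmt-HodgeConjecture-24833`), route of record `HCCMUnconditional`; programme R90-TF (brief `director/R90-BRIEF.v2.md`),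
section S6 (base `R90-C14`), seat R90-C14-p06 (g2); dealer R90-C14-plan (g2) 02:39:30Z ∕ 02:41:15Z («TB2a FILE 2 VALUE → p06 … fibre sum over ★ TL4
(A.3)∕(A.5b)»); this is the structural half (head (V3) of the HEAD BYTES 02:45:43Z), the value file `Theorems/R90S6TwistedConstantTermValue.lean` composes it
with ★ 1c + ★ TJ1 + ★ 1a.  Lane `--kind proof --supports stmt-HodgeConjecture-24833 --as helper`; THEOREMS ONLY (no definition ∕ instance ∕ notation ∕ named
fact ∕ `sorry`).

THE MATHEMATICS [Rogawski1990, §4.10 pp. 57–59; Kottwitz1986BaseChangeUnits §3; Macdonald1995 Ch. V (2.6)].  `K` a non-archimedean local field with a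
continuous involution `σ ≠ id`, `Θ = Θ_σ` (★ `UnitaryGroup.qsInvolution`), `ϖ` a uniformizer, `e = iwasawaExp hϖ : GL₃(K) → ℤ³` the Iwasawa exponent
(★ `SatakeTransformGL`), `A = standardLeviGL K id` the diagonal torus, `δ = diag(d)`, `T = G̃_{δε}` (★ `epsCentralizer ε δ`, `ε = Θ`) with `T ≤ A`.  For
`a = diag(α) ∈ A` the twisted orbit point `a δ Θ(a)⁻¹ = diag(α₀d₀σ(α₂), α₁d₁σ(α₁), α₂d₂σ(α₀))` has exponent
  `e(a δ Θ(a)⁻¹) = e(δ) + (n, 2m, n)`,  `n = e(a)₀ + e(a)₂`, `m = e(a)₁`  (§1, `σ` is an isometry — §0, derived from continuity),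
so the function `z ↦ e(point of z) − e(δ)` on `A ⧸ T` takes values in the ε-NORM FIBRE `{(n, 2m, n)}` (★ TL4 (A.5b)'s `ℤ²`), is locally constant (the sets
`{e = const}` are right `GL₃(𝒪)`-saturated, ★ `isOpen_glInt`), and is SHIFTED by `(n_a, 2m_a, n_a)` under the `A`-action; hence all its fibres are
translates of `U₀ = {z : e(point) = e(δ)}` and have the same `μ_{A∕T}`-mass for any `A`-invariant `μ_{A∕T}` (Mathlib `measure_preimage_smul`).  HEAD (§2):
for every `G : ℤ³ → [0, ∞]`,
  **`∫⁻_{A ⧸ T} G(e(a δ ε(a)⁻¹)) dμ_{A∕T} = μ_{A∕T}(U₀) · Σ'_{(n,m) ∈ ℤ × ℤ} G(e(δ) + (n, 2m, n))`**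
(`lintegral_descEpsConj_comp_iwasawaExp_eq_mul_tsum`; Mathlib `lintegral_countable'`, `Function.Injective.tsum_eq`).  At `G = ` the Kostka count of ★ 1a
`integral_indicator_doubleCoset_mul_eq_gl` this is the twisted constant term of a Hecke shell — the value file.

HONEST LABEL: quotient-measure bookkeeping for E1.4.4.2.1, count-neutral until TB2d consumes it; `μ_{A∕T}(U₀)` stays UNPINNED (no canonical normalisation is chosen
here); proves no printed statement, discharges no citation.  HC_CM is proved only modulo the 7 printed citations (2 remaining named inputs: hLiu418 =
stmt-HodgeConjecture-24832, h413 = stmt-HodgeConjecture-24833) until rung 0 closes; REL ≠ ★ ≠ BUILT.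

## Tree search
★ 1c `R90S6TwistedTorusDescent` (`exists_lintegral_descEpsConj_eq_mul_lintegral_torus_gl`: the consumer of this head; its private `descEpsConj_epsCentralizer_apply_mk`
re-proved privately here), ★ `Ch4Sec10Bridge.mem_epsCentralizer_iff`, ★ `InvariantQuotientChainRule.inclQuot_mk`, ★ `SatakeTransformGL` (`iwasawaExp_eq`,
`iwasawaExp_mul_of_mem_glInt`, `exists_eq_zpow_mul_of_ne_zero`, `diagonalGL_mem_glInt`, `coe_zpowDiagGL`), ★ `ReductiveGroupData.isOpen_glInt`, ★ TL4
`R90S6ApartmentTwistedShell` (A.3a) `diagonalGL_inv_mul_diagonalGL_mul_qsInvolution` ∕ (A.5b) `sub_sub_rev_fin_three` (the `x⁻¹δΘ(x)` convention and valuation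
binders — the present `aδΘ(a)⁻¹ ∕ iwasawaExp` edition is re-derived in 15 lines rather than transported), ★ TJ1 A's private `‖σx‖ = ‖x‖` (re-derived: §0),
★ `normAbs_le_normAbs_iff`; Mathlib `measure_preimage_smul`, `lintegral_countable'`, `lintegral_map`, `measurable_to_countable'`, `Function.Injective.tsum_eq`,
`ENNReal.tsum_mul_right`.  Dedup: `rg "comp_iwasawaExp_eq_mul_tsum|iwasawaExp_mul_mul_qsInvolution_inv|valuation_map_of_continuous"` over `lean/` — no hit.

## References
* [Rogawski1990] J. D. Rogawski, *Automorphic Representations of Unitary Groups in Three Variables*, Ann. of Math. Stud. 123 (1990), §4.10 pp. 57–59.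
* [Kottwitz1986BaseChangeUnits] R. Kottwitz, *Base change for unit elements of Hecke algebras*, Compositio Math. 60 (1986), §1, §3.
* [Macdonald1995] I. G. Macdonald, *Symmetric Functions and Hall Polynomials*, 2nd ed. (1995), Ch. V §2 (2.6), §3 (3.3).
* [WeilBNT1967] A. Weil, *Basic Number Theory* (1967), Ch. I §2.
-/

set_option autoImplicit false
-- the mandated namespace repeats the single-problem summit's segment (`HodgeConjecture.HodgeConjecture`)
set_option linter.dupNamespace false

noncomputable section

open MeasureTheory Measure Set Function Filter Topology
open scoped ENNReal NNReal Pointwise MatrixGroups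
open ValuativeRel
open Literature.NumberTheory.Automorphic Literature.MeasureTheory.Group Literature.NumberTheory.Rogawski1990.Ch4Sec10
open Literature.NumberTheory.GaloisRepresentations Literature.NumberTheory.GaloisRepresentations.IsNonarchimedeanLocalField

namespace Summit.HodgeConjecture.HodgeConjecture.R90.S6

/-! ## §0 A continuous involution of a non-archimedean local field is an isometry -/

section Isometry

variable {K : Type*} [Field K] [ValuativeRel K] [TopologicalSpace K] [IsNonarchimedeanLocalField K]
  (σ : K →+* K) (hσ : ∀ x, σ (σ x) = x) (hσc : Continuous σ)

/-- the Haar character of `y ↦ a y` is `‖a‖_K` (evaluate on `𝒪`; private bridge as in ★ TJ1 A). [cite: WeilBNT1967, Ch. I §2] -/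
private theorem addEquivAddHaarChar_eq_normAbs_of_apply_eq_mul' [MeasurableSpace K] [BorelSpace K] (φ : K ≃ₜ+ K) {a : K} (ha0 : a ≠ 0)
    (hφ : ∀ y, φ y = a * y) : addEquivAddHaarChar φ = normAbs K a := by
  haveI := regular_of_isAddHaarMeasure (addHaar : Measure K)
  have h1 := Literature.MeasureTheory.Group.measure_image_eq_addEquivAddHaarChar_mul (addHaar : Measure K) φ (primePowBall K 0)
  have himg : φ '' primePowBall K 0 = a • primePowBall K 0 := by
    rw [← Set.image_smul]
    exact Set.image_congr fun y _ => hφ y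
  rw [himg, addHaar_smul_set addHaar ha0] at h1
  exact ENNReal.coe_inj.1 ((ENNReal.mul_left_inj (addHaar_primePowBall_pos (addHaar : Measure K) 0).ne'
    (measure_primePowBall_lt_top (addHaar : Measure K) 0).ne).1 h1).symm

include hσ hσc in
/-- **A continuous ring involution of a non-archimedean local field is an ISOMETRY: `v(σ x) = v x`** (its Haar character is `1`, so `‖σx‖ = ‖x‖` by
conjugating `y ↦ x y`; then ★ `normAbs_le_normAbs_iff`).  The valuation binder `hvσ` of the `Valued`-frame files (★ K4 ∕ TL4) DERIVED in the local-field
frame. [cite: WeilBNT1967, Ch. I §2] [cite: Rogawski1990, §1.10 p. 9] -/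
theorem valuation_map_of_continuous_involution (x : K) : valuation K (σ x) = valuation K x := by
  borelize K
  have hnorm : normAbs K (σ x) = normAbs K x := by
    by_cases hx : x = 0
    · rw [hx, map_zero]
    have hσx : σ x ≠ 0 := fun h => hx (by rw [← hσ x, h, map_zero])
    let S : K ≃ₜ+ K :=
      { toFun := σ, invFun := σ, left_inv := hσ, right_inv := hσ, map_add' := map_add σ, continuous_toFun := hσc, continuous_invFun := hσc }
    let Mx : K ≃ₜ+ K :=
      { toFun := fun y => x * y, invFun := fun y => x⁻¹ * y, left_inv := fun y => by simp [hx],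
        right_inv := fun y => by simp [hx], map_add' := fun y y' => mul_add x y y',
        continuous_toFun := continuous_const.mul continuous_id, continuous_invFun := continuous_const.mul continuous_id }
    let Mσx : K ≃ₜ+ K :=
      { toFun := fun y => σ x * y, invFun := fun y => (σ x)⁻¹ * y, left_inv := fun y => by simp [hσx],
        right_inv := fun y => by simp [hσx], map_add' := fun y y' => mul_add (σ x) y y',
        continuous_toFun := continuous_const.mul continuous_id, continuous_invFun := continuous_const.mul continuous_id }
    have hconj : ∀ y, Mσx y = S (Mx (S y)) := fun y => by
      change σ x * y = σ (x * σ y)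
      rw [map_mul, hσ]
    rw [← addEquivAddHaarChar_eq_normAbs_of_apply_eq_mul' Mσx hσx (fun y => rfl), ← addEquivAddHaarChar_eq_normAbs_of_apply_eq_mul' Mx hx (fun y => rfl)]
    exact Literature.MeasureTheory.Group.addEquivAddHaarChar_eq_of_conj_involutive Mx Mσx S hσ hconj
  exact le_antisymm (normAbs_le_normAbs_iff.1 hnorm.le) (normAbs_le_normAbs_iff.1 hnorm.ge)

end Isometry

/-! ## §1 Iwasawa exponents of diagonal elements and of the twisted torus orbit `a δ Θ(a)⁻¹` -/

section Exponents

variable {K : Type*} [Field K] [ValuativeRel K] [IsDiscreteValuationRing 𝒪[K]] {ϖ : K} (hϖ : IsUniformizingElement ϖ)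
include hϖ

/-- **`e(diag(ϖ^{m_i} u_i)) = m`** for units `u_i` (`v(u_i) = 1`): `diag = 1 · ϖ^m · diag(u)` with `diag(u) ∈ GL₃(𝒪)` (★ `iwasawaExp_eq`, ★ `diagonalGL_mem_glInt`).
[cite: Macdonald1995, Ch. V §2 (2.6)] -/
theorem iwasawaExp_eq_of_coe_eq_diagonal {g : GL (Fin 3) K} {y : Fin 3 → K} (hg : (g : Matrix (Fin 3) (Fin 3) K) = Matrix.diagonal y)
    (m : Fin 3 → ℤ) (u : Fin 3 → K) (hu : ∀ i, valuation K (u i) = 1) (hy : ∀ i, y i = ϖ ^ m i * u i) :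
    iwasawaExp hϖ g = m := by
  have hu0 : ∀ i, u i ≠ 0 := fun i h => by have := hu i; rw [h, map_zero] at this; exact zero_ne_one this
  have hk : diagonalGL (Fin 3) K (fun i => Units.mk0 (u i) (hu0 i)) ∈ glInt 3 K := diagonalGL_mem_glInt (fun i => hu i)
  refine iwasawaExp_eq hϖ (upperUnitriangular (Fin 3) K).one_mem hk ?_
  rw [one_mul]
  apply Units.ext
  rw [hg, Units.val_mul, coe_zpowDiagGL, coe_diagonalGL, Matrix.diagonal_mul_diagonal]
  congr 1
  funext i
  rw [hy i, Units.val_mk0]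

variable (σ : K →+* K) (hvσ : ∀ x, valuation K (σ x) = valuation K x)

omit [ValuativeRel K] [IsDiscreteValuationRing 𝒪[K]] hϖ in
/-- **The matrix of the twisted torus orbit point `a · X · Θ_σ(a)⁻¹`** for diagonal `a = diag(α)`, `X = diag(x)`: `diag(α_i x_i σ(α_{rev i}))`
(`Θ_σ(a)⁻¹ = Θ_σ(a⁻¹)` has entries `σ(α_{rev i})`, ★ `coe_qsInvolution_apply`). [cite: Rogawski1990, §4.10 p. 58] -/
theorem coe_mul_mul_qsInvolution_inv_of_diagonal {a X : GL (Fin 3) K} {α x : Fin 3 → K}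
    (haα : (a : Matrix (Fin 3) (Fin 3) K) = Matrix.diagonal α) (hX : (X : Matrix (Fin 3) (Fin 3) K) = Matrix.diagonal x) :
    ((a * X * (UnitaryGroup.qsInvolution σ a)⁻¹ : GL (Fin 3) K) : Matrix (Fin 3) (Fin 3) K) =
      Matrix.diagonal fun i => α i * x i * σ (α i.rev) := by
  have hinv : (UnitaryGroup.qsInvolution σ a)⁻¹ = UnitaryGroup.qsInvolution σ a⁻¹ := by
    refine inv_eq_of_mul_eq_one_right ?_
    rw [← UnitaryGroup.qsInvolution_mul, mul_inv_cancel]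
    have h := UnitaryGroup.qsInvolution_mul σ (1 : GL (Fin 3) K) 1
    rw [one_mul] at h
    exact mul_eq_left.1 h.symm
  have hΘ : ∀ i j, ((UnitaryGroup.qsInvolution σ a⁻¹ : GL (Fin 3) K) : Matrix (Fin 3) (Fin 3) K) i j = σ (Matrix.diagonal α j.rev i.rev) := by
    intro i j
    rw [UnitaryGroup.coe_qsInvolution_apply, inv_inv, haα]
  have hdiagα : (Matrix.diagonal α : Matrix (Fin 3) (Fin 3) K) = !![α 0, 0, 0; 0, α 1, 0; 0, 0, α 2] := by
    ext i j; fin_cases i <;> fin_cases j <;> simp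
  have hdiagx : (Matrix.diagonal x : Matrix (Fin 3) (Fin 3) K) = !![x 0, 0, 0; 0, x 1, 0; 0, 0, x 2] := by
    ext i j; fin_cases i <;> fin_cases j <;> simp
  have hΘm : ((UnitaryGroup.qsInvolution σ a⁻¹ : GL (Fin 3) K) : Matrix (Fin 3) (Fin 3) K) = !![σ (α 2), 0, 0; 0, σ (α 1), 0; 0, 0, σ (α 0)] := by
    ext i j
    rw [hΘ, hdiagα]
    fin_cases i <;> fin_cases j <;> simp [Fin.rev]
  rw [hinv, Units.val_mul, Units.val_mul, haα, hX, hΘm, hdiagα, hdiagx]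
  ext i j
  fin_cases i <;> fin_cases j <;> simp [Matrix.mul_apply, Fin.sum_univ_three, Matrix.diagonal, Fin.rev]

include hvσ in
/-- **THE EXPONENT OF THE TWISTED TORUS ORBIT: `e(a · X · Θ(a)⁻¹) = e(X) + e(a) + w₀ e(a)`** (`(w₀ m)_i = m_{rev i}`) for DIAGONAL `a`, `X` — at `N = 3`
the shift is `(n, 2m, n)`, `n = e(a)₀ + e(a)₂`, `m = e(a)₁`: the ε-norm fibre `≅ ℤ²` of ★ TL4 (A.5b), in the `aδΘ(a)⁻¹ ∕ iwasawaExp` currency of ★ 1c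
(`σ` an isometry, `hvσ`, so `σ(ϖ^k u) = ϖ^k ·` unit). [cite: Kottwitz1986BaseChangeUnits, §3] [cite: Rogawski1990, §4.10 p. 58] -/
theorem iwasawaExp_mul_mul_qsInvolution_inv_of_diagonal {a X : GL (Fin 3) K} {α x : Fin 3 → K}
    (haα : (a : Matrix (Fin 3) (Fin 3) K) = Matrix.diagonal α) (hX : (X : Matrix (Fin 3) (Fin 3) K) = Matrix.diagonal x) :
    iwasawaExp hϖ (a * X * (UnitaryGroup.qsInvolution σ a)⁻¹) =
      fun i => iwasawaExp hϖ X i + (iwasawaExp hϖ a i + iwasawaExp hϖ a i.rev) := by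
  -- entries are non-zero
  have hdetα : (Matrix.diagonal α).det ≠ 0 := by
    rw [← haα, ← Matrix.GeneralLinearGroup.val_det_apply]; exact (Matrix.GeneralLinearGroup.det a).ne_zero
  have hdetx : (Matrix.diagonal x).det ≠ 0 := by
    rw [← hX, ← Matrix.GeneralLinearGroup.val_det_apply]; exact (Matrix.GeneralLinearGroup.det X).ne_zero
  rw [Matrix.det_diagonal] at hdetα hdetx
  have hα0 : ∀ i, α i ≠ 0 := fun i => (Finset.prod_ne_zero_iff.1 hdetα) i (Finset.mem_univ i)
  have hx0 : ∀ i, x i ≠ 0 := fun i => (Finset.prod_ne_zero_iff.1 hdetx) i (Finset.mem_univ i)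
  -- unit decompositions of the entries
  choose ma ua hua hα using fun i => exists_eq_zpow_mul_of_ne_zero hϖ (hα0 i)
  choose mx ux hux hx using fun i => exists_eq_zpow_mul_of_ne_zero hϖ (hx0 i)
  have hea : iwasawaExp hϖ a = ma := iwasawaExp_eq_of_coe_eq_diagonal hϖ haα ma ua hua hα
  have hex : iwasawaExp hϖ X = mx := iwasawaExp_eq_of_coe_eq_diagonal hϖ hX mx ux hux hx
  -- `σ ϖ = ϖ · w` with `w` a unit
  have hϖ0 : ϖ ≠ 0 := hϖ.ne_zero
  set w : K := σ ϖ * ϖ⁻¹ with hw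
  have hwv : valuation K w = 1 := by
    rw [hw, map_mul, map_inv₀, hvσ, mul_inv_cancel₀ ((map_ne_zero (valuation K)).2 hϖ0)]
  have hσϖ : σ ϖ = ϖ * w := by rw [hw, mul_comm (σ ϖ), ← mul_assoc, mul_inv_cancel₀ hϖ0, one_mul]
  have hσzpow : ∀ k : ℤ, σ (ϖ ^ k) = ϖ ^ k * w ^ k := fun k => by rw [map_zpow₀, hσϖ, mul_zpow]
  -- the entries of the twisted point: `ϖ^{…} · unit`
  have hy := coe_mul_mul_qsInvolution_inv_of_diagonal σ haα hX
  refine (iwasawaExp_eq_of_coe_eq_diagonal hϖ hy (fun i => mx i + (ma i + ma i.rev))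
    (fun i => ua i * ux i * (w ^ ma i.rev * σ (ua i.rev))) (fun i => ?_) (fun i => ?_)).trans ?_
  · simp [hua, hux, hvσ, hwv]
  · rw [hα i, hx i, hα i.rev, map_mul, hσzpow, zpow_add₀ hϖ0, zpow_add₀ hϖ0]
    ring
  · rw [hex, hea]

end Exponents

/-! ## §2 The ε-norm fibre sum on `A ⧸ G̃_{δε}` -/

section FibreSum

variable {K : Type*} [Field K] [ValuativeRel K] [TopologicalSpace K] [IsNonarchimedeanLocalField K]
  [IsDiscreteValuationRing 𝒪[K]] {ϖ : K} (hϖ : IsUniformizingElement ϖ)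
  (σ : K →+* K) (hσ : ∀ x, σ (σ x) = x) (hσc : Continuous σ)
  (ε : GL (Fin 3) K →* GL (Fin 3) K) (hε : Continuous ε) (hεΘ : ∀ g, ε g = UnitaryGroup.qsInvolution σ g)
  (δ : GL (Fin 3) K) (d : Fin 3 → K) (hδ : (δ : Matrix (Fin 3) (Fin 3) K) = Matrix.diagonal d)

omit [ValuativeRel K] [TopologicalSpace K] [IsNonarchimedeanLocalField K] [IsDiscreteValuationRing 𝒪[K]] in
/-- `descEpsConj ε δ G_{δε} φ (g G_{δε}) = φ(g δ ε(g)⁻¹)` (local copy of ★ 1c's private lemma). [cite: Rogawski1990, §1.6 p. 5] -/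
private theorem descEpsConj_apply_mk' {α : Type*} (φ : GL (Fin 3) K → α) (g : GL (Fin 3) K) :
    descEpsConj ε δ (epsCentralizer ε δ) φ (QuotientGroup.mk g : GL (Fin 3) K ⧸ epsCentralizer ε δ) = φ (g * δ * (ε g)⁻¹) := by
  obtain ⟨m, hm⟩ := QuotientGroup.mk_out_eq_mul (epsCentralizer ε δ) g
  have hmδ : (m : GL (Fin 3) K) * δ * (ε (m : GL (Fin 3) K))⁻¹ = δ := (mem_epsCentralizer_iff ε δ _).1 m.2
  unfold descEpsConj
  rw [hm, map_mul]
  congr 1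
  calc g * (m : GL (Fin 3) K) * δ * (ε g * ε (m : GL (Fin 3) K))⁻¹ = g * ((m : GL (Fin 3) K) * δ * (ε (m : GL (Fin 3) K))⁻¹) * (ε g)⁻¹ := by group
    _ = g * δ * (ε g)⁻¹ := by rw [hmδ]

omit [ValuativeRel K] [TopologicalSpace K] [IsNonarchimedeanLocalField K] [IsDiscreteValuationRing 𝒪[K]] in
/-- an element of the diagonal torus has a diagonal matrix. [folklore] -/
private theorem coe_eq_diagonal_of_mem_standardLeviGL {a : GL (Fin 3) K} (ha : a ∈ standardLeviGL K (_root_.id : Fin 3 → Fin 3)) :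
    (a : Matrix (Fin 3) (Fin 3) K) = Matrix.diagonal fun i => (a : Matrix (Fin 3) (Fin 3) K) i i := by
  ext i j
  by_cases hij : i = j
  · subst hij; rw [Matrix.diagonal_apply_eq]
  · rw [Matrix.diagonal_apply_ne _ hij]
    exact (mem_standardLeviGL_iff (_root_.id : Fin 3 → Fin 3) a).1 ha i j hij

include hϖ in
/-- **`{g : e(g) = m}` is OPEN** (it is right-`GL₃(𝒪)`-saturated: `e(g k) = e(g)`, and `GL₃(𝒪)` is open ★ `isOpen_glInt`): the Iwasawa exponent is locally constant.
[cite: Macdonald1995, Ch. V §2] -/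
theorem isOpen_setOf_iwasawaExp_eq (m : Fin 3 → ℤ) : IsOpen {g : GL (Fin 3) K | iwasawaExp hϖ g = m} := by
  refine isOpen_iff_mem_nhds.2 fun g hg => ?_
  have hopen : IsOpen ((fun x : GL (Fin 3) K => g⁻¹ * x) ⁻¹' (glInt 3 K : Set (GL (Fin 3) K))) :=
    (isOpen_glInt 3 K).preimage (continuous_const.mul continuous_id)
  refine Filter.mem_of_superset (hopen.mem_nhds ?_) fun x hx => ?_
  · change g⁻¹ * g ∈ glInt 3 K
    rw [inv_mul_cancel]
    exact (glInt 3 K).one_mem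
  · have hx' : g⁻¹ * x ∈ glInt 3 K := hx
    have : x = g * (g⁻¹ * x) := by rw [mul_inv_cancel_left]
    rw [Set.mem_setOf_eq, this, iwasawaExp_mul_of_mem_glInt hϖ g hx']
    exact hg

include hϖ hσ hσc hεΘ hδ hε in
/-- **THE ε-NORM FIBRE SUM.**  With `T = G̃_{δε} ≤ A = standardLeviGL K id` (`hTA`), `μ_{A∕T}` ANY `A`-invariant measure on `A ⧸ T`, `e = iwasawaExp hϖ` and
`U₀ = {z : e(a_z δ ε(a_z)⁻¹) = e(δ)}`: for every `G : ℤ³ → [0, ∞]`,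
**`∫⁻ z, G(e(a_z δ ε(a_z)⁻¹)) dμ_{A∕T} = μ_{A∕T}(U₀) · Σ'_{p ∈ ℤ × ℤ} G(e(δ) + (p.1, 2·p.2, p.1))`** — the outer integral of ★ 1c's twisted torus descent as a sum
over the ε-norm fibre through `e(δ)` (§1: the integrand depends on `z = aT` only through `(e(a)₀ + e(a)₂, e(a)₁) ∈ ℤ²`, which SHIFTS under the `A`-action, so every
fibre is a translate of `U₀` and has mass `μ_{A∕T}(U₀)` by invariance; ★ `isOpen_glInt` makes the fibres clopen, hence Borel).
[cite: Rogawski1990, §4.10 Prop. 4.10.2 proof p. 59] [cite: Kottwitz1986BaseChangeUnits, §3] -/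
theorem lintegral_descEpsConj_comp_iwasawaExp_eq_mul_tsum
    {A : Subgroup (GL (Fin 3) K)} (hAid : A = standardLeviGL K (_root_.id : Fin 3 → Fin 3)) (hTA : epsCentralizer ε δ ≤ A)
    [MeasurableSpace (↥A ⧸ (epsCentralizer ε δ).subgroupOf A)] [BorelSpace (↥A ⧸ (epsCentralizer ε δ).subgroupOf A)]
    (μAT : Measure (↥A ⧸ (epsCentralizer ε δ).subgroupOf A)) [SMulInvariantMeasure ↥A (↥A ⧸ (epsCentralizer ε δ).subgroupOf A) μAT]
    (G : (Fin 3 → ℤ) → ℝ≥0∞) :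
    ∫⁻ z, descEpsConj ε δ (epsCentralizer ε δ) (fun m => G (iwasawaExp hϖ m)) (inclQuot (epsCentralizer ε δ) A z) ∂μAT =
      μAT {z | descEpsConj ε δ (epsCentralizer ε δ) (fun m => iwasawaExp hϖ m) (inclQuot (epsCentralizer ε δ) A z) = iwasawaExp hϖ δ} *
        ∑' p : ℤ × ℤ, G (iwasawaExp hϖ δ + ![p.1, 2 * p.2, p.1]) := by
  have _ := hTA
  have hvσ : ∀ x, valuation K (σ x) = valuation K x := valuation_map_of_continuous_involution σ hσ hσc
  have hmemA : ∀ a : ↥A, (a : GL (Fin 3) K) ∈ standardLeviGL K (_root_.id : Fin 3 → Fin 3) := fun a => hAid ▸ a.2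
  -- the exponent shift of the twisted point along `A`
  set Ψ : (↥A ⧸ (epsCentralizer ε δ).subgroupOf A) → (Fin 3 → ℤ) := fun z =>
    descEpsConj ε δ (epsCentralizer ε δ) (fun m => iwasawaExp hϖ m) (inclQuot (epsCentralizer ε δ) A z) - iwasawaExp hϖ δ with hΨ
  set ι : ℤ × ℤ → (Fin 3 → ℤ) := fun p => ![p.1, 2 * p.2, p.1] with hι
  have hι_inj : Function.Injective ι := by
    intro p q h
    have h0 : p.1 = q.1 := by simpa [hι] using congrFun h 0
    have h1 : 2 * p.2 = 2 * q.2 := by simpa [hι] using congrFun h 1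
    exact Prod.ext h0 (by omega)
  set sh : ↥A → ℤ × ℤ := fun a =>
    (iwasawaExp hϖ (a : GL (Fin 3) K) 0 + iwasawaExp hϖ (a : GL (Fin 3) K) 2, iwasawaExp hϖ (a : GL (Fin 3) K) 1) with hsh
  -- `e(a X ε(a)⁻¹) = e(X) + ι (sh a)` for `a ∈ A`, `X` diagonal
  have hshift : ∀ (a : ↥A) {X : GL (Fin 3) K} {x : Fin 3 → K}, (X : Matrix (Fin 3) (Fin 3) K) = Matrix.diagonal x →
      iwasawaExp hϖ ((a : GL (Fin 3) K) * X * (ε (a : GL (Fin 3) K))⁻¹) = iwasawaExp hϖ X + ι (sh a) := by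
    intro a X x hX
    rw [hεΘ, iwasawaExp_mul_mul_qsInvolution_inv_of_diagonal hϖ σ hvσ (coe_eq_diagonal_of_mem_standardLeviGL (hmemA a)) hX]
    funext i
    fin_cases i
    · simp [hι, hsh, Fin.rev]
    · simp [hι, hsh, Fin.rev, two_mul]
    · simp [hι, hsh, Fin.rev, add_comm]
  -- `Ψ (a T) = ι (sh a)`, and every twisted orbit point is diagonal
  have hpt_diag : ∀ b : ↥A, ((((b : GL (Fin 3) K) * δ * (ε (b : GL (Fin 3) K))⁻¹ : GL (Fin 3) K)) : Matrix (Fin 3) (Fin 3) K) =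
      Matrix.diagonal fun i => ((b : GL (Fin 3) K) : Matrix (Fin 3) (Fin 3) K) i i * d i *
        σ (((b : GL (Fin 3) K) : Matrix (Fin 3) (Fin 3) K) i.rev i.rev) := by
    intro b
    rw [hεΘ]
    exact coe_mul_mul_qsInvolution_inv_of_diagonal σ (coe_eq_diagonal_of_mem_standardLeviGL (hmemA b)) hδ
  have hΨmk : ∀ a : ↥A, Ψ (QuotientGroup.mk a) = ι (sh a) := by
    intro a
    simp only [hΨ, inclQuot_mk, descEpsConj_apply_mk' ε δ]
    rw [hshift a hδ, add_sub_cancel_left]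
  -- the `A`-action shifts `Ψ`: `Ψ (a • z) = Ψ z + ι (sh a)`
  have hΨsmul : ∀ (a : ↥A) (z : ↥A ⧸ (epsCentralizer ε δ).subgroupOf A), Ψ (a • z) = Ψ z + ι (sh a) := by
    intro a z
    induction z using QuotientGroup.induction_on with
    | H b =>
      have hab : a • (QuotientGroup.mk b : ↥A ⧸ (epsCentralizer ε δ).subgroupOf A) = QuotientGroup.mk (a * b) := rfl
      rw [hab]
      simp only [hΨ, inclQuot_mk, descEpsConj_apply_mk' ε δ, Subgroup.coe_mul, map_mul]
      have hgrp : (a : GL (Fin 3) K) * (b : GL (Fin 3) K) * δ * (ε (a : GL (Fin 3) K) * ε (b : GL (Fin 3) K))⁻¹ =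
          (a : GL (Fin 3) K) * ((b : GL (Fin 3) K) * δ * (ε (b : GL (Fin 3) K))⁻¹) * (ε (a : GL (Fin 3) K))⁻¹ := by group
      rw [hgrp, hshift a (hpt_diag b)]
      abel
  -- the fibres of `Ψ` are Borel (open) …
  have hmk_cont : Continuous fun a : ↥A => (a : GL (Fin 3) K) * δ * (ε (a : GL (Fin 3) K))⁻¹ :=
    ((continuous_subtype_val.mul continuous_const).mul (hε.comp continuous_subtype_val).inv)
  have hfib_open : ∀ v : Fin 3 → ℤ, IsOpen (Ψ ⁻¹' {v}) := by
    intro v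
    rw [← (QuotientGroup.isOpenQuotientMap_mk (G := ↥A) (N := (epsCentralizer ε δ).subgroupOf A)).isQuotientMap.isOpen_preimage]
    have hset : (QuotientGroup.mk : ↥A → ↥A ⧸ (epsCentralizer ε δ).subgroupOf A) ⁻¹' (Ψ ⁻¹' {v}) =
        (fun a : ↥A => (a : GL (Fin 3) K) * δ * (ε (a : GL (Fin 3) K))⁻¹) ⁻¹' {g : GL (Fin 3) K | iwasawaExp hϖ g = v + iwasawaExp hϖ δ} := by
      ext a
      simp only [Set.mem_preimage, Set.mem_singleton_iff, Set.mem_setOf_eq, hΨ, inclQuot_mk, descEpsConj_apply_mk' ε δ]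
      exact sub_eq_iff_eq_add
    rw [hset]
    exact (isOpen_setOf_iwasawaExp_eq hϖ _).preimage hmk_cont
  have hfib_meas : ∀ v : Fin 3 → ℤ, MeasurableSet (Ψ ⁻¹' {v}) := fun v => (hfib_open v).measurableSet
  have hΨmeas : Measurable Ψ := measurable_to_countable' hfib_meas
  -- … and translates of one another: equal mass
  have hvol : ∀ p : ℤ × ℤ, μAT (Ψ ⁻¹' {ι p}) = μAT (Ψ ⁻¹' {0}) := by
    intro p
    -- `a_p = ϖ^{(p.1, p.2, 0)} ∈ A` has shift `sh a_p = p`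
    have hmem : zpowDiagGL hϖ.ne_zero ![p.1, p.2, 0] ∈ A := by
      rw [hAid, mem_standardLeviGL_iff]
      intro i j hij
      rw [coe_zpowDiagGL]
      exact Matrix.diagonal_apply_ne _ hij
    have hshap : sh ⟨_, hmem⟩ = p := by
      have he : iwasawaExp hϖ (zpowDiagGL hϖ.ne_zero ![p.1, p.2, 0]) = ![p.1, p.2, 0] :=
        iwasawaExp_eq hϖ (upperUnitriangular (Fin 3) K).one_mem (glInt 3 K).one_mem (by rw [one_mul, mul_one])
      simp only [hsh, he]
      simp
    -- `sh (a_p⁻¹) = −p` through the shift law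
    have hinvsh : ι (sh (⟨_, hmem⟩ : ↥A)⁻¹) = -ι p := by
      have h := hΨsmul ⟨_, hmem⟩ ((⟨_, hmem⟩ : ↥A)⁻¹ • (QuotientGroup.mk 1 : ↥A ⧸ (epsCentralizer ε δ).subgroupOf A))
      rw [smul_smul, mul_inv_cancel, one_smul, hΨsmul, hshap, add_assoc, left_eq_add] at h
      exact eq_neg_of_add_eq_zero_left h
    have hset : Ψ ⁻¹' {ι p} = (fun z => (⟨_, hmem⟩ : ↥A)⁻¹ • z) ⁻¹' (Ψ ⁻¹' {0}) := by
      ext z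
      simp only [Set.mem_preimage, Set.mem_singleton_iff]
      rw [hΨsmul, hinvsh, add_neg_eq_zero]
    rw [hset, measure_preimage_smul]
  -- the range of `Ψ` lies in the fibre lattice
  have hrange : ∀ z, Ψ z ∈ Set.range ι := by
    intro z
    induction z using QuotientGroup.induction_on with
    | H a => exact ⟨sh a, (hΨmk a).symm⟩
  -- rewrite the integrand through `Ψ`
  have hint : (fun z => descEpsConj ε δ (epsCentralizer ε δ) (fun m => G (iwasawaExp hϖ m)) (inclQuot (epsCentralizer ε δ) A z)) =
      fun z => (fun v : Fin 3 → ℤ => G (iwasawaExp hϖ δ + v)) (Ψ z) := by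
    funext z
    induction z using QuotientGroup.induction_on with
    | H a => simp only [hΨ, inclQuot_mk, descEpsConj_apply_mk' ε δ, add_sub_cancel]
  have hU₀ : {z | descEpsConj ε δ (epsCentralizer ε δ) (fun m => iwasawaExp hϖ m) (inclQuot (epsCentralizer ε δ) A z) = iwasawaExp hϖ δ} =
      Ψ ⁻¹' {0} := by
    ext z
    simp only [Set.mem_setOf_eq, Set.mem_preimage, Set.mem_singleton_iff, hΨ, sub_eq_zero]
  have hsub : ∫⁻ z, (fun v : Fin 3 → ℤ => G (iwasawaExp hϖ δ + v)) (Ψ z) ∂μAT = ∫⁻ v, G (iwasawaExp hϖ δ + v) ∂(Measure.map Ψ μAT) :=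
    (lintegral_map (f := fun v : Fin 3 → ℤ => G (iwasawaExp hϖ δ + v)) (measurable_of_countable _) hΨmeas).symm
  rw [hint, hU₀, hsub, lintegral_countable']
  -- reindex the sum along `ι`
  have hzero : ∀ v : Fin 3 → ℤ, v ∉ Set.range ι → (Measure.map Ψ μAT) {v} = 0 := by
    intro v hv
    rw [Measure.map_apply hΨmeas (measurableSet_singleton v)]
    have : Ψ ⁻¹' {v} = ∅ := Set.eq_empty_iff_forall_notMem.2 fun z hz => hv (hz ▸ hrange z)
    rw [this, measure_empty]
  have hsupp : Function.support (fun v : Fin 3 → ℤ => G (iwasawaExp hϖ δ + v) * (Measure.map Ψ μAT) {v}) ⊆ Set.range ι := by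
    intro v hv
    by_contra h
    exact hv (by simp only [hzero v h, mul_zero])
  rw [← hι_inj.tsum_eq hsupp]
  have hterm : ∀ p : ℤ × ℤ, G (iwasawaExp hϖ δ + ι p) * (Measure.map Ψ μAT) {ι p} = G (iwasawaExp hϖ δ + ι p) * μAT (Ψ ⁻¹' {0}) := by
    intro p
    rw [Measure.map_apply hΨmeas (measurableSet_singleton _), hvol p]
  simp_rw [hterm]
  rw [ENNReal.tsum_mul_right, mul_comm]

end FibreSum

end Summit.HodgeConjecture.HodgeConjecture.R90.S6

end
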